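import Literature.AlgebraicTopology.SingularHomology.LocalHomology
import Literature.Algebra.Homology.DoubleComplexExactRows
import Literature.Algebra.Homology.CechTupleFaces
import HarnessLib

/-!
# The Čech–singular double complex: singular cochains of an acyclic cover

The singular-cochain counterpart of the Čech–de Rham double complex (R. Bott, L. W. Tu,
*Differential Forms in Algebraic Topology* (1982), §8 and §15, Thm. 15.8 / proof of Thm. 8.9
with `Ω^*` replaced by singular cochains; A. Weil, *Sur les théorèmes de de Rham* (1952), §3;
R. Godement, *Théorie des faisceaux* (1958), II.5.4, "Leray's theorem on acyclic covers"): for a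
family of subsets `𝔘 = (U_i)_{i ∈ ι}` of a space `X` let
`K^{p,q} = C^p(𝔘, C^q) = Π_{J : Fin (p+1) → ι} Hom_R(C_q(U_J), N)` be the Čech cochains of the
presheaf of singular `q`-cochains (`U_J = ⋂ U_{J k}`, cochains of a subset computed inside `C(X)`
as in `Literature.AlgebraicTopology.SingularHomology.SubsetCochains`), with the Čech differential
`δ` horizontally and `(-1)^p` times the singular coboundary vertically.

* The rows, augmented by the **`𝔘`-small cochains** `Hom_R(C^𝔘_q, N)`
  (`C^𝔘 = Σ_i C(U_i)`, `Literature.AlgebraicTopology.SingularHomology.smallSub`) through the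
  restrictions, are EXACT — with no hypothesis on `𝔘` at all: choosing for every `𝔘`-small
  simplex `σ` an index `i(σ)` with `σ ⊆ U_{i(σ)}`, `(h c)_J(σ) = c_{(i(σ), J)}(σ)` is a contracting
  homotopy (the combinatorial analogue of the partition-of-unity argument, Bott–Tu Prop. 8.5;
  `cechSingular_rowExact`, `cechSingularRow_exact`);
* the columns, augmented by the Čech complex `cechZeroδ` of `0`-COCYCLES `Z⁰(U_J)`, are exact as
  soon as every `U_J` has no cohomology in positive degrees (hypothesis `hacyc` of
  `cechSingular_colExact`; for a good cover: contractibility);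
* hence (`Literature.Algebra.Homology.ADoubleComplex.rowColEquiv`, Weibel's Acyclic Assembly
  Lemma) **`cechSingularEquiv`: `Hⁿ(Hom(C^𝔘, N)) ≃ₗ[R] Hⁿ(C^•(𝔘, Z⁰), δ)`** for every `n`.

With `𝔘` an open cover, `Hⁿ(Hom(C^𝔘, N)) = Hⁿ(X; N)` by the small-chains theorem (Hatcher
Prop. 2.21, the tree's `isIso_homologyMap_ι_smallSub`, dualised by
`isIso_homologyMap_dualMap_of_quasiIso`); that bridge to the categorical cohomology of the tree,
and the identification of `C^•(𝔘, Z⁰)` with the Čech complex of locally constant functions, are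
left to the consumers (the de Rham theorem files). Cochains are modelled CONCRETELY as `R`-linear
maps `C_q(A) →ₗ[R] N` on the chain modules `(chainsInSub R R X A).toComplex.X q` of the tree
(`CochainOn`), so that `subsetCochains R N A` is recovered by `ModuleCat.ofHom`; `cechSet` repeats
verbatim the definition of `Literature.Geometry.Kaehler.cechSet` (the two files must not import
each other). No topology is used in this file beyond the types; no named facts; everything is
proved.

## References

* R. Bott, L. W. Tu, *Differential Forms in Algebraic Topology*, GTM 82, Springer 1982, §8
  (Prop. 8.5, Thm. 8.9), §15 (Thm. 15.8). [BottTu1982Forms]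
* A. Hatcher, *Algebraic Topology*, CUP 2002, §2.1 (chains in a subspace, Prop. 2.21), §3.1
  p. 197 (cochains). [HatcherAT2002]
* C. A. Weibel, *An Introduction to Homological Algebra*, CUP 1994, Lemma 2.7.3. [Weibel1994]
-/

noncomputable section

-- as in `SingularChainsConcrete` / `LocalHomology` / `CechDualityChartConvex`: chains of the
-- concrete complex are `Finsupp`s up to unfolding of semireducible definitions
set_option backward.isDefEq.respectTransparency false

open CategoryTheory Literature.Algebra.Homology

universe u v w

namespace Literature.AlgebraicTopology.SingularHomology

variable {R : Type v} [CommRing R] {X : Type u} [TopologicalSpace X]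
  {N : Type w} [AddCommGroup N] [Module R N] {ι : Type*}

/-! ### Finite intersections indexed by tuples -/

/-- The finite intersection `U_J = ⋂ k, U (J k)` attached to a tuple of indices (verbatim the
`cechSet` of `Literature.Geometry.Kaehler.CechDeRham`; Bott–Tu (1982), §8). [cite: BottTu1982Forms, §8 (8.1)] -/
def cechSet (U : ι → Set X) {n : ℕ} (J : Fin n → ι) : Set X :=
  ⋂ k, U (J k)

omit [TopologicalSpace X] in
/-- Membership in a finite intersection. [folklore] -/
theorem mem_cechSet_iff {U : ι → Set X} {n : ℕ} {J : Fin n → ι} {x : X} :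
    x ∈ cechSet U J ↔ ∀ k, x ∈ U (J k) :=
  Set.mem_iInter

omit [TopologicalSpace X] in
/-- `U_J ⊆ U_{J ∘ θ}`. [folklore] -/
theorem cechSet_subset_comp (U : ι → Set X) {m n : ℕ} (J : Fin n → ι) (θ : Fin m → Fin n) :
    cechSet U J ⊆ cechSet U (J ∘ θ) :=
  fun _ hx ↦ mem_cechSet_iff.2 fun k ↦ mem_cechSet_iff.1 hx (θ k)

omit [TopologicalSpace X] in
/-- `U_J ⊆ U_{J k}`. [folklore] -/
theorem cechSet_subset_apply (U : ι → Set X) {n : ℕ} (J : Fin n → ι) (k : Fin n) :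
    cechSet U J ⊆ U (J k) :=
  fun _ hx ↦ mem_cechSet_iff.1 hx k

omit [TopologicalSpace X] in
/-- `U_i ⊆ U_{(i, …, i)}`-type inclusion for `1`-tuples: `U_{J 0} ⊆ U_J` when `J : Fin 1 → ι`.
[folklore] -/
theorem subset_cechSet_fin_one (U : ι → Set X) (J : Fin 1 → ι) : U (J 0) ⊆ cechSet U J :=
  fun _ hx ↦ mem_cechSet_iff.2 fun k ↦ by rwa [Subsingleton.elim k 0]

omit [TopologicalSpace X] in
/-- `U_{(a, J)} = U_a ∩ U_J`. [folklore] -/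
theorem cechSet_cons (U : ι → Set X) {n : ℕ} (a : ι) (J : Fin n → ι) :
    cechSet U (Fin.cons a J : Fin (n + 1) → ι) = U a ∩ cechSet U J := by
  ext x
  simp only [mem_cechSet_iff, Set.mem_inter_iff, Fin.forall_fin_succ, Fin.cons_zero, Fin.cons_succ]

/-! ### Concrete cochains of a subset, restriction, coboundary -/

variable (R N) in
/-- **Singular `q`-cochains of `A ⊆ X` with values in `N`**, computed inside `C(X)`: `R`-linear maps
`C_q(A; R) →ₗ[R] N` on the chains with image in `A` (Hatcher 2002, §3.1 p. 197; the `ModuleCat`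
object `subsetCochains R N A` of the tree has these as elements via `ModuleCat.Hom.hom`).
[cite: HatcherAT2002, §3.1 p. 197] -/
abbrev CochainOn (A : Set X) (q : ℕ) : Type _ :=
  ((chainsInSub R R X A).toComplex.X q) →ₗ[R] N

/-- **Restriction of cochains** along `A ⊆ B` (precomposition with the inclusion of chains;
Hatcher 2002, §3.1 p. 199). [cite: HatcherAT2002, §3.1 p. 199] -/
def cres {A B : Set X} (h : A ⊆ B) (q : ℕ) : CochainOn R N B q →ₗ[R] CochainOn R N A q where
  toFun ψ := ψ ∘ₗ ((Subcomplex.incl (chainsInSub_mono R R h)).f q).hom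
  map_add' _ _ := LinearMap.add_comp _ _ _
  map_smul' _ _ := LinearMap.smul_comp _ _ _

/-- Restriction is precomposition with the inclusion. [folklore] -/
theorem cres_apply {A B : Set X} (h : A ⊆ B) {q : ℕ} (ψ : CochainOn R N B q)
    (c : (chainsInSub R R X A).toComplex.X q) :
    cres h q ψ c = ψ (((Subcomplex.incl (chainsInSub_mono R R h)).f q).hom c) :=
  rfl

/-- **The coboundary** `ψ ↦ ψ ∘ ∂` on the cochains of `A` (Hatcher 2002, §3.1, `δ = ∂*`).
[cite: HatcherAT2002, §3.1 p. 197] -/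
def cod (A : Set X) (q : ℕ) : CochainOn R N A q →ₗ[R] CochainOn R N A (q + 1) where
  toFun ψ := ψ ∘ₗ ((chainsInSub R R X A).toComplex.d (q + 1) q).hom
  map_add' _ _ := LinearMap.add_comp _ _ _
  map_smul' _ _ := LinearMap.smul_comp _ _ _

/-- The coboundary is precomposition with the boundary. [folklore] -/
theorem cod_apply {A : Set X} {q : ℕ} (ψ : CochainOn R N A q)
    (c : (chainsInSub R R X A).toComplex.X (q + 1)) :
    cod A q ψ c = ψ (((chainsInSub R R X A).toComplex.d (q + 1) q).hom c) :=
  rfl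

/-- `δ ∘ δ = 0` (`∂ ∘ ∂ = 0`). [cite: HatcherAT2002, §3.1 p. 197] -/
theorem cod_cod {A : Set X} {q : ℕ} (ψ : CochainOn R N A q) : cod A (q + 1) (cod A q ψ) = 0 := by
  have h := congrArg (ModuleCat.Hom.hom (R := R))
    ((chainsInSub R R X A).toComplex.d_comp_d (q + 1 + 1) (q + 1) q)
  rw [ModuleCat.hom_comp, ModuleCat.hom_zero] at h
  change (ψ ∘ₗ ((chainsInSub R R X A).toComplex.d (q + 1) q).hom) ∘ₗ
    ((chainsInSub R R X A).toComplex.d (q + 1 + 1) (q + 1)).hom = 0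
  rw [LinearMap.comp_assoc, h, LinearMap.comp_zero]

/-- Restriction commutes with the coboundary (the inclusion of chains is a chain map).
[cite: HatcherAT2002, §3.1 p. 199] -/
theorem cres_cod {A B : Set X} (h : A ⊆ B) {q : ℕ} (ψ : CochainOn R N B q) :
    cres h (q + 1) (cod B q ψ) = cod A q (cres h q ψ) := by
  have hc := congrArg (ModuleCat.Hom.hom (R := R)) ((Subcomplex.incl (chainsInSub_mono R R h)).comm (q + 1) q)
  rw [ModuleCat.hom_comp, ModuleCat.hom_comp] at hc
  change (ψ ∘ₗ ((chainsInSub R R X B).toComplex.d (q + 1) q).hom) ∘ₗ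
      ((Subcomplex.incl (chainsInSub_mono R R h)).f (q + 1)).hom =
    (ψ ∘ₗ ((Subcomplex.incl (chainsInSub_mono R R h)).f q).hom) ∘ₗ
      ((chainsInSub R R X A).toComplex.d (q + 1) q).hom
  rw [LinearMap.comp_assoc, hc, ← LinearMap.comp_assoc]

/-- Restrictions compose. [folklore] -/
theorem cres_cres {A B C : Set X} (h : A ⊆ B) (h' : B ⊆ C) {q : ℕ} (ψ : CochainOn R N C q) :
    cres h q (cres h' q ψ) = cres (h.trans h') q ψ := by
  have hc := congrArg (fun φ ↦ ModuleCat.Hom.hom (R := R) (HomologicalComplex.Hom.f φ q))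
    (Subcomplex.incl_comp_incl (chainsInSub_mono R R h) (chainsInSub_mono R R h'))
  simp only [HomologicalComplex.comp_f, ModuleCat.hom_comp] at hc
  change (ψ ∘ₗ _) ∘ₗ _ = ψ ∘ₗ _
  rw [LinearMap.comp_assoc, hc]

/-! ### Elementary chains and the values of a cochain on simplices -/

/-- The elementary chain `σ` (coefficient `1`) of a simplex with image in `A`, as an element of
`C_q(A)`. [folklore] -/
def elemChain {A : Set X} {q : ℕ} {σ : SingularSimplex X q} (hσ : σ.range ⊆ A) :
    (chainsInSub R R X A).toComplex.X q :=
  ⟨Finsupp.single σ (1 : R), single_mem_chainsIn R R hσ 1⟩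

/-- The underlying chain of an elementary chain. [folklore] -/
theorem coe_elemChain {A : Set X} {q : ℕ} {σ : SingularSimplex X q} (hσ : σ.range ⊆ A) :
    (elemChain (R := R) hσ : (chainsInSub R R X A).toComplex.X q).1 = Finsupp.single σ 1 :=
  rfl

/-- The inclusion of chains sends elementary chains to elementary chains. [folklore] -/
theorem incl_elemChain {A B : Set X} (h : A ⊆ B) {q : ℕ} {σ : SingularSimplex X q}
    (hσ : σ.range ⊆ A) :
    ((Subcomplex.incl (chainsInSub_mono R R h)).f q).hom (elemChain (R := R) hσ) =
      elemChain (hσ.trans h) :=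
  rfl

open Classical in
/-- **The value of a cochain on a simplex, extended by zero**: `ψ(σ)` if `σ ⊆ A`, else `0` (a
total function of the simplex, convenient for the Čech bookkeeping). [folklore] -/
def evalSimplex {A : Set X} {q : ℕ} (ψ : CochainOn R N A q) (σ : SingularSimplex X q) : N :=
  if h : σ.range ⊆ A then ψ (elemChain h) else 0

/-- The value on a simplex of `A`. [folklore] -/
theorem evalSimplex_of_subset {A : Set X} {q : ℕ} (ψ : CochainOn R N A q) {σ : SingularSimplex X q}
    (hσ : σ.range ⊆ A) : evalSimplex ψ σ = ψ (elemChain hσ) := by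
  rw [evalSimplex, dif_pos hσ]

/-- `evalSimplex` is additive in the cochain. [folklore] -/
theorem evalSimplex_add {A : Set X} {q : ℕ} (ψ ψ' : CochainOn R N A q) (σ : SingularSimplex X q) :
    evalSimplex (ψ + ψ') σ = evalSimplex ψ σ + evalSimplex ψ' σ := by
  by_cases h : σ.range ⊆ A
  · rw [evalSimplex_of_subset _ h, evalSimplex_of_subset _ h, evalSimplex_of_subset _ h, LinearMap.add_apply]
  · simp only [evalSimplex, dif_neg h, add_zero]

/-- `evalSimplex` is homogeneous in the cochain. [folklore] -/
theorem evalSimplex_smul {A : Set X} {q : ℕ} (r : R) (ψ : CochainOn R N A q) (σ : SingularSimplex X q) :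
    evalSimplex (r • ψ) σ = r • evalSimplex ψ σ := by
  by_cases h : σ.range ⊆ A
  · rw [evalSimplex_of_subset _ h, evalSimplex_of_subset _ h, LinearMap.smul_apply]
  · simp only [evalSimplex, dif_neg h, smul_zero]

/-- `evalSimplex` of a finite sum of cochains. [folklore] -/
theorem evalSimplex_sum {A : Set X} {q : ℕ} {β : Type*} (s : Finset β) (ψ : β → CochainOn R N A q)
    (σ : SingularSimplex X q) : evalSimplex (∑ b ∈ s, ψ b) σ = ∑ b ∈ s, evalSimplex (ψ b) σ := by
  classical
  induction s using Finset.induction_on with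
  | empty =>
    by_cases h : σ.range ⊆ A
    · rw [Finset.sum_empty, Finset.sum_empty, evalSimplex_of_subset _ h, LinearMap.zero_apply]
    · simp only [Finset.sum_empty, evalSimplex, dif_neg h]
  | insert b s hb ih => rw [Finset.sum_insert hb, Finset.sum_insert hb, evalSimplex_add, ih]

/-- **Restriction does not change the values on the simplices of the smaller set.** [folklore] -/
theorem evalSimplex_cres {A B : Set X} (h : A ⊆ B) {q : ℕ} (ψ : CochainOn R N B q)
    {σ : SingularSimplex X q} (hσ : σ.range ⊆ A) : evalSimplex (cres h q ψ) σ = evalSimplex ψ σ := by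
  rw [evalSimplex_of_subset _ hσ, evalSimplex_of_subset _ (hσ.trans h), cres_apply, incl_elemChain h]

/-- **A cochain of `A` is determined by its values on the simplices of `A`** (`C_q(A)` is free
on them, Hatcher 2002, §2.1; same argument as the tree's `subsetCochains.hom_ext_single`).
[cite: HatcherAT2002, §2.1] -/
theorem ext_evalSimplex {A : Set X} {q : ℕ} {ψ ψ' : CochainOn R N A q}
    (h : ∀ σ : SingularSimplex X q, σ.range ⊆ A → evalSimplex ψ σ = evalSimplex ψ' σ) : ψ = ψ' := by
  classical
  set ρ := Finsupp.restrictDom R R (simplicesIn X A q) with hρ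
  have key : ψ ∘ₗ ρ = ψ' ∘ₗ ρ := by
    refine Finsupp.lhom_ext fun σ b ↦ ?_
    change ψ (ρ (Finsupp.single σ b)) = ψ' (ρ (Finsupp.single σ b))
    by_cases hσ : σ.range ⊆ A
    · have e : ρ (Finsupp.single σ b) = b • elemChain (R := R) hσ := by
        apply Subtype.ext
        rw [hρ, Finsupp.restrictDom_apply, Submodule.coe_smul, elemChain, Finsupp.smul_single_one]
        exact Finsupp.filter_single_of_pos (p := (· ∈ simplicesIn X A q)) hσ
      rw [e, map_smul, map_smul, ← evalSimplex_of_subset ψ hσ, ← evalSimplex_of_subset ψ' hσ, h σ hσ]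
    · have e : ρ (Finsupp.single σ b) = 0 := by
        apply Subtype.ext
        rw [hρ, Finsupp.restrictDom_apply]
        exact Finsupp.filter_single_of_neg (p := (· ∈ simplicesIn X A q)) hσ
      rw [e, map_zero, map_zero]
  refine LinearMap.ext fun x ↦ ?_
  have hx : ρ (x.1 : CChain R X q) = x := by
    apply Subtype.ext
    rw [hρ, Finsupp.restrictDom_apply, Finsupp.filter_eq_self_iff]
    intro σ hσ
    exact (mem_chainsIn_iff R R _).mp x.2 σ (Finsupp.mem_support_iff.mpr hσ)
  have e := congrArg (fun f ↦ f (x.1 : CChain R X q)) key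
  change ψ (ρ (x.1 : CChain R X q)) = ψ' (ρ (x.1 : CChain R X q)) at e
  rwa [hx] at e

/-- `(-1)^p • x = 0 ↔ x = 0` over any commutative ring (`(-1)^p` is a unit). [folklore] -/
theorem neg_one_pow_smul_eq_zero_iff {M' : Type*} [AddCommGroup M'] [Module R M'] (p : ℕ) (x : M') :
    (-1 : R) ^ p • x = 0 ↔ x = 0 := by
  refine ⟨fun h ↦ ?_, fun h ↦ by rw [h, smul_zero]⟩
  have h' := congrArg (fun y ↦ (-1 : R) ^ p • y) h
  simp only [smul_smul, ← pow_add, ← two_mul, pow_mul, neg_one_sq, one_pow, one_smul, smul_zero] at h'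
  exact h'

/-! ### The Čech–singular double complex -/

variable (R N) in
/-- **The Čech `p`-cochains with values in singular `q`-cochains**, `C^p(𝔘, C^q) = Π_J C^q(U_J; N)`
over all ordered `(p+1)`-tuples (Bott–Tu (1982), §8 p. 93, with `Ω^q` replaced by singular
cochains as in §15). [cite: BottTu1982Forms, §15 Thm. 15.8] -/
abbrev CechCochain (U : ι → Set X) (p q : ℕ) : Type _ :=
  ∀ J : Fin (p + 1) → ι, CochainOn R N (cechSet U J) q

section Cech

variable (U : ι → Set X)

variable (R N) in
/-- **The Čech differential** `(δ c)_J = Σ_j (-1)^j c_{J ∘ σ_j}|_{U_J}` (Bott–Tu (1982), (8.4)).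
[cite: BottTu1982Forms, §8 (8.4)] -/
def cechδ (p q : ℕ) : CechCochain R N U p q →ₗ[R] CechCochain R N U (p + 1) q where
  toFun c J := ∑ j : Fin (p + 2), (-1 : R) ^ (j : ℕ) •
    cres (cechSet_subset_comp U J (Fin.succAbove j)) q (c (J ∘ Fin.succAbove j))
  map_add' c c' := by
    funext J
    simp only [Pi.add_apply, map_add, smul_add, Finset.sum_add_distrib]
  map_smul' r c := by
    funext J
    simp only [Pi.smul_apply, map_smul, RingHom.id_apply, Finset.smul_sum, smul_smul, mul_comm r]

/-- The Čech differential, componentwise. [cite: BottTu1982Forms, §8 (8.4)] -/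
theorem cechδ_apply {p q : ℕ} (c : CechCochain R N U p q) (J : Fin (p + 2) → ι) :
    cechδ R N U p q c J = ∑ j : Fin (p + 2), (-1 : R) ^ (j : ℕ) •
      cres (cechSet_subset_comp U J (Fin.succAbove j)) q (c (J ∘ Fin.succAbove j)) :=
  rfl

/-- **The Čech differential on the values**: for `σ ⊆ U_J`,
`(δ c)_J(σ) = Σ_j (-1)^j c_{J ∘ σ_j}(σ)`. [cite: BottTu1982Forms, §8 (8.4)] -/
theorem evalSimplex_cechδ {p q : ℕ} (c : CechCochain R N U p q) {J : Fin (p + 2) → ι}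
    {σ : SingularSimplex X q} (hσ : σ.range ⊆ cechSet U J) :
    evalSimplex (cechδ R N U p q c J) σ =
      ∑ j : Fin (p + 2), (-1 : R) ^ (j : ℕ) • evalSimplex (c (J ∘ Fin.succAbove j)) σ := by
  rw [cechδ_apply, evalSimplex_sum]
  refine Finset.sum_congr rfl fun j _ ↦ ?_
  rw [evalSimplex_smul, evalSimplex_cres _ _ hσ]

variable (R N) in
/-- **The vertical differential** `(-1)^p δ_sing` (Weibel's sign trick 1.2.5). [cite: Weibel1994, 1.2.5] -/
def cechd (p q : ℕ) : CechCochain R N U p q →ₗ[R] CechCochain R N U p (q + 1) where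
  toFun c J := (-1 : R) ^ p • cod (cechSet U J) q (c J)
  map_add' c c' := by
    funext J
    simp only [Pi.add_apply, map_add, smul_add]
  map_smul' r c := by
    funext J
    simp only [Pi.smul_apply, map_smul, RingHom.id_apply, smul_comm r]

/-- The vertical differential, componentwise. [cite: Weibel1994, 1.2.5] -/
theorem cechd_apply {p q : ℕ} (c : CechCochain R N U p q) (J : Fin (p + 1) → ι) :
    cechd R N U p q c J = (-1 : R) ^ p • cod (cechSet U J) q (c J) :=
  rfl

variable (R N) in
/-- **The Čech–singular double complex** `C^p(𝔘, C^q)` as an anticommuting double complex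
(`δ ∘ δ = 0` by `CechTuple.sum_sum_neg_one_pow_smul_smul_faces_eq_zero`, `d ∘ d = 0` by
`cod_cod`, anticommutation by `cres_cod` and the sign). [cite: BottTu1982Forms, §15 Thm. 15.8] -/
def cechSingular : ADoubleComplex R (CechCochain R N U) where
  d p q := cechd R N U p q
  δ p q := cechδ R N U p q
  d_d p q c := by
    funext J
    rw [cechd_apply, cechd_apply, map_smul, cod_cod, smul_zero, smul_zero]
    rfl
  δ_δ p q c := by
    funext J
    rw [cechδ_apply, Pi.zero_apply]
    simp_rw [cechδ_apply, map_sum, map_smul, cres_cres, Finset.smul_sum]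
    exact CechTuple.sum_sum_neg_one_pow_smul_smul_faces_eq_zero (R := R)
      (fun θ ↦ cres (cechSet_subset_comp U J θ) q (c (J ∘ θ)))
  anticomm p q c := by
    funext J
    rw [Pi.add_apply, Pi.zero_apply, cechδ_apply, cechd_apply, cechδ_apply, map_sum, Finset.smul_sum,
      ← Finset.sum_add_distrib]
    refine Finset.sum_eq_zero fun j _ ↦ ?_
    rw [cechd_apply, map_smul, map_smul, cres_cod, smul_smul, smul_smul, ← add_smul,
      show (-1 : R) ^ (j : ℕ) * (-1) ^ p + (-1) ^ (p + 1) * (-1) ^ (j : ℕ) = 0 by ring, zero_smul]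

/-! ### The row augmentation: `𝔘`-small cochains -/

variable (R N) in
/-- **The `𝔘`-small `q`-cochains** `Hom_R(C^𝔘_q, N)`, `C^𝔘 = Σ_i C(U_i)` (Hatcher 2002,
Prop. 2.21 / §3.1 p. 204 "`Cⁿ(A + B; G)`"). [cite: HatcherAT2002, §3.1 p. 204] -/
abbrev SmallCochain (q : ℕ) : Type _ :=
  ((smallSub R R X U).toComplex.X q) →ₗ[R] N

/-- `C(U_J) ≤ C^𝔘` for a `1`-tuple `J = (i)`. [folklore] -/
theorem chainsInSub_cechSet_le_smallSub (J : Fin 1 → ι) :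
    chainsInSub R R X (cechSet U J) ≤ smallSub R R X U :=
  (chainsInSub_mono R R (cechSet_subset_apply U J 0)).trans
    (fun n ↦ le_iSup (fun i ↦ chainsIn R R X (U i) n) (J 0))

variable (R N) in
/-- **The row augmentation** by the small cochains: `a ↦ (a|_{C(U_i)})_i` (Bott–Tu (1982), §8,
the restriction `r`; Hatcher §3.1 p. 204). [cite: BottTu1982Forms, §8 Prop. 8.5] -/
def cechSingularRow : (cechSingular R N U).RowAugmentation (SmallCochain R N U) where
  dA q :=
    { toFun := fun a ↦ a ∘ₗ ((smallSub R R X U).toComplex.d (q + 1) q).hom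
      map_add' := fun _ _ ↦ LinearMap.add_comp _ _ _
      map_smul' := fun _ _ ↦ LinearMap.smul_comp _ _ _ }
  ε q :=
    { toFun := fun a J ↦ a ∘ₗ ((Subcomplex.incl (chainsInSub_cechSet_le_smallSub U J)).f q).hom
      map_add' := fun _ _ ↦ by funext J; exact LinearMap.add_comp _ _ _
      map_smul' := fun _ _ ↦ by funext J; exact LinearMap.smul_comp _ _ _ }
  ε_dA q a := by
    funext J
    change (a ∘ₗ ((smallSub R R X U).toComplex.d (q + 1) q).hom) ∘ₗ
        ((Subcomplex.incl (chainsInSub_cechSet_le_smallSub U J)).f (q + 1)).hom =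
      (-1 : R) ^ 0 • ((a ∘ₗ ((Subcomplex.incl (chainsInSub_cechSet_le_smallSub U J)).f q).hom) ∘ₗ
        ((chainsInSub R R X (cechSet U J)).toComplex.d (q + 1) q).hom)
    have hc := congrArg (ModuleCat.Hom.hom (R := R))
      ((Subcomplex.incl (chainsInSub_cechSet_le_smallSub U J)).comm (q + 1) q)
    rw [ModuleCat.hom_comp, ModuleCat.hom_comp] at hc
    rw [pow_zero, one_smul, LinearMap.comp_assoc, hc, ← LinearMap.comp_assoc]
  δ_ε q a := by
    funext J
    change cechδ R N U 0 q (fun J ↦ a ∘ₗ ((Subcomplex.incl (chainsInSub_cechSet_le_smallSub U J)).f q).hom) J = 0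
    rw [cechδ_apply, Fin.sum_univ_two, Fin.val_zero, pow_zero, one_smul, Fin.val_one, pow_one,
      neg_one_smul, add_neg_eq_zero]
    have key : ∀ j : Fin 2,
        cres (cechSet_subset_comp U J (Fin.succAbove j)) q
          (a ∘ₗ ((Subcomplex.incl (chainsInSub_cechSet_le_smallSub U (J ∘ Fin.succAbove j))).f q).hom) =
        a ∘ₗ ((Subcomplex.incl ((chainsInSub_mono R R (cechSet_subset_comp U J (Fin.succAbove j))).trans
          (chainsInSub_cechSet_le_smallSub U (J ∘ Fin.succAbove j)))).f q).hom := by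
      intro j
      have hc := congrArg (fun φ ↦ ModuleCat.Hom.hom (R := R) (HomologicalComplex.Hom.f φ q))
        (Subcomplex.incl_comp_incl (chainsInSub_mono R R (cechSet_subset_comp U J (Fin.succAbove j)))
          (chainsInSub_cechSet_le_smallSub U (J ∘ Fin.succAbove j)))
      simp only [HomologicalComplex.comp_f, ModuleCat.hom_comp] at hc
      change (a ∘ₗ _) ∘ₗ _ = _
      rw [LinearMap.comp_assoc, hc]
    rw [key, key]

/-- The row augmentation on the values: `(r a)_J(σ) = a(σ)` for `σ ⊆ U_J`. [folklore] -/
theorem cechSingularRow_ε_apply_elemChain {q : ℕ} (a : SmallCochain R N U q) (J : Fin 1 → ι)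
    {σ : SingularSimplex X q} (hσ : σ.range ⊆ cechSet U J) :
    (cechSingularRow R N U).ε q a J (elemChain hσ) =
      a ⟨Finsupp.single σ 1, chainsInSub_cechSet_le_smallSub U J q (single_mem_chainsIn R R hσ 1)⟩ :=
  rfl

/-! ### Exactness of the rows: the index-choice contraction -/

/-- **Choice of an index for each simplex**: `smallIdx J σ` is some `i` with `σ ⊆ U_i` when there is
one (the default `J 0` is never used on small simplices). [folklore] -/
def smallIdx {p q : ℕ} (J : Fin (p + 1) → ι) (σ : SingularSimplex X q) : ι := by
  classical
  exact if h : ∃ i, σ.range ⊆ U i then h.choose else J 0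

/-- The chosen index works. [folklore] -/
theorem subset_smallIdx {p q : ℕ} (J : Fin (p + 1) → ι) {σ : SingularSimplex X q} {i : ι}
    (h : σ.range ⊆ U i) : σ.range ⊆ U (smallIdx U J σ) := by
  classical
  have hex : ∃ i, σ.range ⊆ U i := ⟨i, h⟩
  rw [smallIdx, dif_pos hex]
  exact hex.choose_spec

/-- The chosen index does not depend on the auxiliary tuple. [folklore] -/
theorem smallIdx_eq_smallIdx {p p' q : ℕ} (J : Fin (p + 1) → ι) (J' : Fin (p' + 1) → ι)
    {σ : SingularSimplex X q} {i : ι} (h : σ.range ⊆ U i) : smallIdx U J σ = smallIdx U J' σ := by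
  classical
  have hex : ∃ i, σ.range ⊆ U i := ⟨i, h⟩
  rw [smallIdx, smallIdx, dif_pos hex, dif_pos hex]

/-- A simplex of `U_J` lies in `U_{(smallIdx σ, J)}`. [folklore] -/
theorem subset_cechSet_cons_smallIdx {p p' q : ℕ} (J : Fin (p + 1) → ι) (J' : Fin (p' + 1) → ι)
    {σ : SingularSimplex X q} (hσ : σ.range ⊆ cechSet U J) :
    σ.range ⊆ cechSet U (Fin.cons (smallIdx U J' σ) J : Fin (p + 2) → ι) := by
  rw [cechSet_cons]
  exact Set.subset_inter (subset_smallIdx U J' (hσ.trans (cechSet_subset_apply U J 0))) hσ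

open Classical in
/-- **The contracting homotopy** `(h c)_J(σ) = c_{(smallIdx σ, J)}(σ)`, defined on the free module
`C_q(U_J)` through its basis of simplices (the combinatorial analogue of Bott–Tu's
`Σ_i ρ_i c_{(i, J)}`, Prop. 8.5). [cite: BottTu1982Forms, Prop. 8.5] -/
def cechContract {p q : ℕ} (c : CechCochain R N U (p + 1) q) (J : Fin (p + 1) → ι) :
    CochainOn R N (cechSet U J) q where
  toFun x := Finsupp.linearCombination R (fun σ : SingularSimplex X q ↦
      if h : σ.range ⊆ cechSet U J then
        c (Fin.cons (smallIdx U J σ) J) (elemChain (subset_cechSet_cons_smallIdx U J J h))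
      else 0) x.1
  map_add' x y := map_add _ x.1 y.1
  map_smul' r x := map_smul _ r x.1

/-- The value of the contraction on a simplex of `U_J`. [cite: BottTu1982Forms, Prop. 8.5] -/
theorem evalSimplex_cechContract {p q : ℕ} (c : CechCochain R N U (p + 1) q) (J : Fin (p + 1) → ι)
    {σ : SingularSimplex X q} (hσ : σ.range ⊆ cechSet U J) :
    evalSimplex (cechContract U c J) σ = evalSimplex (c (Fin.cons (smallIdx U J σ) J)) σ := by
  classical
  rw [evalSimplex_of_subset _ hσ, evalSimplex_of_subset _ (subset_cechSet_cons_smallIdx U J J hσ)]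
  change Finsupp.linearCombination R _ (Finsupp.single σ 1) = _
  rw [Finsupp.linearCombination_single, one_smul, dif_pos hσ]

/-- **The cocycle identity behind the contraction**: if `δ c = 0` then for `σ ⊆ U_i ∩ U_J`,
`c_J(σ) = Σ_j (-1)^j c_{(i, J ∘ σ_j)}(σ)`. [cite: BottTu1982Forms, Prop. 8.5] -/
theorem evalSimplex_eq_sum_of_cechδ_eq_zero {p q : ℕ} {c : CechCochain R N U (p + 1) q}
    (hc : cechδ R N U (p + 1) q c = 0) (J : Fin (p + 2) → ι) (i : ι) {σ : SingularSimplex X q}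
    (hσi : σ.range ⊆ U i) (hσ : σ.range ⊆ cechSet U J) :
    evalSimplex (c J) σ = ∑ j : Fin (p + 2), (-1 : R) ^ (j : ℕ) •
      evalSimplex (c (Fin.cons i (J ∘ Fin.succAbove j) : Fin (p + 2) → ι)) σ := by
  have hσc : σ.range ⊆ cechSet U (Fin.cons i J : Fin (p + 3) → ι) := by
    rw [cechSet_cons]
    exact Set.subset_inter hσi hσ
  have h0 : evalSimplex (cechδ R N U (p + 1) q c (Fin.cons i J : Fin (p + 3) → ι)) σ = 0 := by
    rw [hc, Pi.zero_apply, evalSimplex_of_subset _ hσc, LinearMap.zero_apply]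
  rw [evalSimplex_cechδ U c hσc,
    CechTuple.sum_neg_one_pow_smul_cons_faces (R := R) i J (fun S ↦ evalSimplex (c S) σ), sub_eq_zero] at h0
  exact h0

/-- **The cocycle identity in the column `0`**: if `δ c = 0` for a `0`-cochain `c` then
`c_{(i)}(σ) = c_J(σ)` for `σ ⊆ U_i ∩ U_J`, `J` a `1`-tuple. [cite: BottTu1982Forms, Prop. 8.5] -/
theorem evalSimplex_eq_evalSimplex_of_cechδ_eq_zero {q : ℕ} {c : CechCochain R N U 0 q}
    (hc : cechδ R N U 0 q c = 0) (J : Fin 1 → ι) (i : ι) {σ : SingularSimplex X q}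
    (hσi : σ.range ⊆ U i) (hσ : σ.range ⊆ cechSet U J) :
    evalSimplex (c fun _ ↦ i) σ = evalSimplex (c J) σ := by
  have hσc : σ.range ⊆ cechSet U (Fin.cons i J : Fin 2 → ι) := by
    rw [cechSet_cons]
    exact Set.subset_inter hσi hσ
  have h0 : evalSimplex (cechδ R N U 0 q c (Fin.cons i J : Fin 2 → ι)) σ = 0 := by
    rw [hc, Pi.zero_apply, evalSimplex_of_subset _ hσc, LinearMap.zero_apply]
  rw [evalSimplex_cechδ U c hσc, Fin.sum_univ_two, Fin.val_zero, pow_zero, one_smul, Fin.val_one,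
    pow_one, neg_one_smul, add_neg_eq_zero] at h0
  have e0 : ((Fin.cons i J : Fin 2 → ι) ∘ Fin.succAbove (0 : Fin 2)) = J :=
    CechTuple.cons_comp_succAbove_zero i J
  have e1 : ((Fin.cons i J : Fin 2 → ι) ∘ Fin.succAbove (1 : Fin 2)) = fun _ ↦ i := by
    funext k
    rw [Subsingleton.elim k 0]
    rfl
  have f0 := congrArg (fun S : Fin 1 → ι ↦ evalSimplex (c S) σ) e0
  have f1 := congrArg (fun S : Fin 1 → ι ↦ evalSimplex (c S) σ) e1
  exact (f0.symm.trans (h0.trans f1)).symm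

/-- **Exactness of the Čech rows in positive columns** for the presheaf of singular cochains of
ANY family of subsets: if `δ c = 0` then `c = δ (h c)` (Bott–Tu (1982), Prop. 8.5, combinatorial
form). [cite: BottTu1982Forms, Prop. 8.5] -/
theorem cechSingular_rowExact : (cechSingular R N U).RowExact := by
  refine ⟨fun p q c hc ↦ ⟨cechContract U c, ?_⟩⟩
  funext T
  refine ext_evalSimplex fun σ hσ ↦ ?_
  change evalSimplex (cechδ R N U p q (cechContract U c) T) σ = evalSimplex (c T) σ
  rw [evalSimplex_cechδ U _ hσ]
  have hσ0 : σ.range ⊆ U (T 0) := hσ.trans (cechSet_subset_apply U T 0)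
  calc ∑ j : Fin (p + 2), (-1 : R) ^ (j : ℕ) • evalSimplex (cechContract U c (T ∘ Fin.succAbove j)) σ
      = ∑ j : Fin (p + 2), (-1 : R) ^ (j : ℕ) •
          evalSimplex (c (Fin.cons (smallIdx U T σ) (T ∘ Fin.succAbove j) : Fin (p + 2) → ι)) σ := by
        refine Finset.sum_congr rfl fun j _ ↦ ?_
        rw [evalSimplex_cechContract U c _ (hσ.trans (cechSet_subset_comp U T _)),
          smallIdx_eq_smallIdx U (T ∘ Fin.succAbove j) T hσ0]
    _ = evalSimplex (c T) σ :=
        (evalSimplex_eq_sum_of_cechδ_eq_zero U hc T (smallIdx U T σ) (subset_smallIdx U T hσ0) hσ).symm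

open Classical in
/-- **Gluing a `0`-cocycle of cochains into a small cochain**: `a(σ) = c_{(i(σ))}(σ)` on the basis
of small simplices. [cite: BottTu1982Forms, Prop. 8.5] -/
def glueSmall {q : ℕ} (c : CechCochain R N U 0 q) : SmallCochain R N U q where
  toFun x := Finsupp.linearCombination R (fun σ : SingularSimplex X q ↦
      if h : ∃ i, σ.range ⊆ U i then evalSimplex (c fun _ ↦ h.choose) σ else 0) x.1
  map_add' x y := map_add _ x.1 y.1
  map_smul' r x := map_smul _ r x.1

/-- **Exactness of the augmented rows at the column `0`**: the restriction to the pieces is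
injective on small cochains, and a `δ`-cocycle of cochains glues to a small cochain
(Bott–Tu (1982), Prop. 8.5 in degree `0`). [cite: BottTu1982Forms, Prop. 8.5] -/
theorem cechSingularRow_exact : (cechSingularRow R N U).Exact := by
  classical
  constructor
  · -- injectivity: a small cochain vanishing on every `C(U_i)` vanishes on `Σ C(U_i)`
    intro q
    rw [injective_iff_map_eq_zero]
    intro a ha
    refine LinearMap.ext fun x ↦ ?_
    suffices h : ∀ (y : CChain R X q) (hy : y ∈ smallChains R R X U q), a ⟨y, hy⟩ = 0 from h x.1 x.2
    intro y hy
    induction hy using Submodule.iSup_induction' with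
    | mem i y hy =>
      have hJ : y ∈ chainsIn R R X (cechSet U (fun _ : Fin 1 ↦ i)) q :=
        chainsIn_mono R R (subset_cechSet_fin_one U fun _ ↦ i) q hy
      have h := congrArg (fun c : CechCochain R N U 0 q ↦ c (fun _ ↦ i) ⟨y, hJ⟩) ha
      exact h
    | zero => exact map_zero a
    | add y z hy hz ihy ihz =>
      change a ((⟨y, hy⟩ : (smallSub R R X U).toComplex.X q) +
        (⟨z, hz⟩ : (smallSub R R X U).toComplex.X q)) = 0
      rw [map_add, ihy, ihz, add_zero]
  · -- gluing
    intro q c hc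
    refine ⟨glueSmall U c, ?_⟩
    funext J
    refine ext_evalSimplex fun σ hσ ↦ ?_
    have hσ0 : σ.range ⊆ U (J 0) := hσ.trans (cechSet_subset_apply U J 0)
    have hex : ∃ i, σ.range ⊆ U i := ⟨J 0, hσ0⟩
    rw [evalSimplex_of_subset _ hσ, cechSingularRow_ε_apply_elemChain]
    change Finsupp.linearCombination R _ (Finsupp.single σ 1) = _
    rw [Finsupp.linearCombination_single, one_smul, dif_pos hex]
    exact evalSimplex_eq_evalSimplex_of_cechδ_eq_zero U hc J hex.choose hex.choose_spec hσ

/-! ### The column augmentation: `0`-cocycles -/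

variable (R N) in
/-- **The `0`-cocycles** `Z⁰(A; N) = ker (δ : C⁰(A) → C¹(A))` (cochains constant along paths of
`A`). [cite: HatcherAT2002, §3.1 p. 199] -/
abbrev zeroCocycles (A : Set X) : Submodule R (CochainOn R N A 0) :=
  LinearMap.ker (cod A 0)

/-- Restriction preserves `0`-cocycles. [folklore] -/
theorem cres_mem_zeroCocycles {A B : Set X} (h : A ⊆ B) {ψ : CochainOn R N B 0}
    (hψ : ψ ∈ zeroCocycles R N B) : cres h 0 ψ ∈ zeroCocycles R N A := by
  rw [LinearMap.mem_ker] at hψ ⊢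
  rw [← cres_cod, hψ, map_zero]

variable (R N) in
/-- **The Čech `p`-cochains with values in `0`-cocycles**, `C^p(𝔘, Z⁰)`. [cite: BottTu1982Forms, Thm. 8.9] -/
abbrev CechZeroCocycles (U : ι → Set X) (p : ℕ) : Type _ :=
  ∀ J : Fin (p + 1) → ι, ↥(zeroCocycles R N (cechSet U J))

variable (R N) in
/-- **The Čech differential on `0`-cocycles** (same formula (8.4)). [cite: BottTu1982Forms, §8 (8.4)] -/
def cechZeroδ (p : ℕ) : CechZeroCocycles R N U p →ₗ[R] CechZeroCocycles R N U (p + 1) where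
  toFun b J := ∑ j : Fin (p + 2), (-1 : R) ^ (j : ℕ) •
    (⟨cres (cechSet_subset_comp U J (Fin.succAbove j)) 0 (b (J ∘ Fin.succAbove j)),
      cres_mem_zeroCocycles _ (b _).2⟩ : zeroCocycles R N (cechSet U J))
  map_add' b b' := by
    funext J
    apply Subtype.ext
    simp only [Pi.add_apply, Submodule.coe_add, Submodule.coe_sum, Submodule.coe_smul, map_add,
      smul_add, Finset.sum_add_distrib]
  map_smul' r b := by
    funext J
    apply Subtype.ext
    simp only [Pi.smul_apply, Submodule.coe_smul, Submodule.coe_sum, map_smul, RingHom.id_apply,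
      Finset.smul_sum, smul_smul, mul_comm r]

/-- The Čech differential on `0`-cocycles, on underlying cochains. [cite: BottTu1982Forms, §8 (8.4)] -/
theorem coe_cechZeroδ_apply {p : ℕ} (b : CechZeroCocycles R N U p) (J : Fin (p + 2) → ι) :
    (cechZeroδ R N U p b J : CochainOn R N (cechSet U J) 0) = ∑ j : Fin (p + 2), (-1 : R) ^ (j : ℕ) •
      cres (cechSet_subset_comp U J (Fin.succAbove j)) 0
        (b (J ∘ Fin.succAbove j) : CochainOn R N (cechSet U (J ∘ Fin.succAbove j)) 0) := by
  change ((∑ j : Fin (p + 2), (-1 : R) ^ (j : ℕ) •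
    (⟨cres (cechSet_subset_comp U J (Fin.succAbove j)) 0 (b (J ∘ Fin.succAbove j)),
      cres_mem_zeroCocycles _ (b _).2⟩ : zeroCocycles R N (cechSet U J)) :
        zeroCocycles R N (cechSet U J)) : CochainOn R N (cechSet U J) 0) = _
  rw [Submodule.coe_sum]
  simp only [Submodule.coe_smul]

variable (R N) in
/-- The inclusion `Z⁰(U_J) ↪ C⁰(U_J)` on Čech cochains. [folklore] -/
def cechZeroIncl (p : ℕ) : CechZeroCocycles R N U p →ₗ[R] CechCochain R N U p 0 where
  toFun b J := (b J : CochainOn R N (cechSet U J) 0)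
  map_add' _ _ := rfl
  map_smul' _ _ := rfl

variable (R N) in
/-- **The column augmentation** by the Čech complex of `0`-cocycles. [cite: BottTu1982Forms, Thm. 8.9] -/
def cechSingularCol : (cechSingular R N U).ColAugmentation (CechZeroCocycles R N U) where
  dA p := cechZeroδ R N U p
  ε p := cechZeroIncl R N U p
  ε_dA p b := by
    funext J
    change (cechZeroδ R N U p b J : CochainOn R N (cechSet U J) 0) =
      cechδ R N U p 0 (cechZeroIncl R N U p b) J
    rw [coe_cechZeroδ_apply, cechδ_apply]
    rfl
  δ_ε p b := by
    funext J
    change (-1 : R) ^ p • cod (cechSet U J) 0 (b J : CochainOn R N (cechSet U J) 0) = 0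
    rw [LinearMap.mem_ker.1 (b J).2, smul_zero]

/-- **Exactness of the augmented columns at the row `0`** (tautological: `Z⁰ = ker δ₀`).
[cite: BottTu1982Forms, Thm. 8.9] -/
theorem cechSingularCol_exact : (cechSingularCol R N U).Exact := by
  constructor
  · intro p b b' h
    funext J
    apply Subtype.ext
    exact congrArg (fun c : CechCochain R N U p 0 ↦ c J) h
  · intro p c hc
    have hker : ∀ J, c J ∈ zeroCocycles R N (cechSet U J) := fun J ↦ by
      rw [LinearMap.mem_ker]
      have h := congrFun hc J
      change (-1 : R) ^ p • cod (cechSet U J) 0 (c J) = 0 at h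
      exact (neg_one_pow_smul_eq_zero_iff p _).1 h
    exact ⟨fun J ↦ ⟨c J, hker J⟩, rfl⟩

/-- **Exactness of the columns in positive rows from acyclicity of the finite intersections**:
if every `U_J` has exact cochain complex in positive degrees (`H^{q+1}(U_J; N) = 0`, e.g. `U_J`
contractible), the columns `(C^p(𝔘, C^•), (-1)^p δ_sing)` are exact in positive degrees.
[cite: BottTu1982Forms, Thm. 8.9] -/
theorem cechSingular_colExact
    (hacyc : ∀ (p q : ℕ) (J : Fin (p + 1) → ι) (ψ : CochainOn R N (cechSet U J) (q + 1)),
      cod (cechSet U J) (q + 1) ψ = 0 → ∃ φ : CochainOn R N (cechSet U J) q, cod (cechSet U J) q φ = ψ) :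
    (cechSingular R N U).ColExact := by
  refine ⟨fun p q c hc ↦ ?_⟩
  have hex : ∀ J, ∃ φ : CochainOn R N (cechSet U J) q, cod (cechSet U J) q φ = c J := fun J ↦ by
    apply hacyc
    have h := congrFun hc J
    change (-1 : R) ^ p • cod (cechSet U J) (q + 1) (c J) = 0 at h
    exact (neg_one_pow_smul_eq_zero_iff p _).1 h
  choose φ hφ using hex
  refine ⟨fun J ↦ (-1 : R) ^ p • φ J, ?_⟩
  funext J
  change (-1 : R) ^ p • cod (cechSet U J) q ((-1 : R) ^ p • φ J) = c J
  rw [map_smul, smul_smul, ← pow_add, ← two_mul, pow_mul, neg_one_sq, one_pow, one_smul, hφ]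

/-! ### The comparison -/

/-- **Čech comparison for the singular cochains of an acyclic family** (Leray's acyclic-cover
theorem for singular cochains, in the form of Bott–Tu (1982), Thm. 8.9 / Thm. 15.8): if every
finite intersection `U_J` of the family `𝔘` has exact cochain complex in positive degrees, then
the cohomology of the `𝔘`-small cochains `Hom(C^𝔘, N)` is isomorphic, in every degree, to the
cohomology of the Čech complex `(C^•(𝔘, Z⁰), δ)` of `0`-cocycles. (For `𝔘` an open cover,
`Hⁿ(Hom(C^𝔘, N)) = Hⁿ(X; N)` by Hatcher's Prop. 2.21.) [cite: BottTu1982Forms, Thm. 15.8] -/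
def cechSingularEquiv
    (hacyc : ∀ (p q : ℕ) (J : Fin (p + 1) → ι) (ψ : CochainOn R N (cechSet U J) (q + 1)),
      cod (cechSet U J) (q + 1) ψ = 0 → ∃ φ : CochainOn R N (cechSet U J) q, cod (cechSet U J) q φ = ψ)
    (n : ℕ) :
    NatCochain.Cohomology (cechSingularRow R N U).dA n ≃ₗ[R]
      NatCochain.Cohomology (cechZeroδ R N U) n :=
  ADoubleComplex.rowColEquiv (cechSingularRow R N U) (cechSingularCol R N U)
    (cechSingular_rowExact U) (cechSingularRow_exact U) (cechSingular_colExact U hacyc)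
    (cechSingularCol_exact U) n

end Cech

end Literature.AlgebraicTopology.SingularHomology
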